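import Summits.ValiantsHypothesis.ValiantsHypothesis.Theorems.KPlusLogSqLawTridiagonalRealStaticUnitCrossingDirection

/-!
# Route «KPlusLogSqLaw», crux `WeakLifting` (stmt-ValiantsHypothesis-19561) — REAL side of the tridiagonal sector:
# the UNIT-COEFFICIENT sub-sector, ALL SIZES — crossing direction in the EXTREME inertia classes (any slope signs)

HONEST FRAMING.  Helper theorems (`--supports stmt-ValiantsHypothesis-19561 --as helper`), seat val-sym-lift-p1 (g18), cell `pub-symmetroid`,
2026-08-28; companion of `…UnitCrossingDirection` (p633123), `…UnitKernelVector` (p633729) and `…UnitEntropyBalance` (p632571).  Currency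
`StaticTridiagonalRealPotential.pathDet (fun _ => 1) d (fun _ => 1) f`, energies `e_k = D_kD_{k+1}x^{−2F_k}` (sign of the `k`-th pivot) at a
nondegenerate zero `x` of `D_m`, `m = n + 2`.  By p633729 `−Σ_k L_k e_k` is the Hellmann–Feynman velocity `wᵀ(xJ')w` of the zero eigenvalue and
`(log x)·Σ_k L_k e_k = −Σ_{interior} φ` (entropy balance).  In the two EXTREME pivot patterns every vertex term has the same sign, so the
direction is decided for ALL exponents (no recessiveness, no separation hypothesis):
* **TOP CLASS** (`balance_neg_of_alternating`): alternating pivots (`(−1)^k D_kD_{k+1} > 0`, the maximally indefinite pattern of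
  `…StaticTridiagonalTopClass`, even `m`) ⇒ `Σ_k (d_k+d_{k+1}−2f_k)·log x·e_k < 0`: every interior vertex is an `N`- or `J`-vertex and COSTS
  entropy; hence (`slopeEnergy_pos_above_one_of_alternating`, `slopeEnergy_neg_below_one_of_alternating`) `Σ_k L_k e_k > 0` for `x > 1` and `< 0`
  for `x < 1` — a top-class zero always adds a negative eigenvalue in the direction AWAY from the resonance `x = 1`;
* **BOTTOM CLASS** (`balance_pos_of_positive`): all pivots positive (`D_kD_{k+1} > 0`, the positive-semidefinite zeros of
  `…StaticTridiagonalDefiniteInterval`) ⇒ the balance is `> 0`: a bottom-class zero adds a negative eigenvalue TOWARDS the resonance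
  (below `1` the design leaves positive definiteness as `x` increases, above `1` it enters it).
These are the direction supplements of lift-p2 g9's interval theorems (`Z₀ ≤ 2`, `Z_top ≤ 2`), in the unit slice.  Nothing here is an upper law for
the register (α NO MOVER); nothing bears on `WeakLifting` / `TropicalB` (stmt-19771) in their windows, Conjecture B, the Door-A registers,
`MatrixDescartes` (stmt-18050) or VP ≠ VNP.
[this seat; folklore: continuants / LDLᵀ pivots, binary entropy]
-/

-- `Summit.ValiantsHypothesis.ValiantsHypothesis.…` repeats a component by the D-0017 layout (single-conjunct summit); the name is mandated.
set_option linter.dupNamespace false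
set_option autoImplicit false

namespace Summit.ValiantsHypothesis.ValiantsHypothesis.Theorems.KPlusLogSqLaw
namespace StaticTridiagonalRealUnit

open Real Finset Polynomial
open Summit.ValiantsHypothesis.ValiantsHypothesis.Theorems.KPlusLogSqLaw.StaticTridiagonalRealPotential (pathDet)

variable (d : ℕ → ℕ) (f : ℕ → ℕ)

/-- vertex term of an `N`-vertex `(a, −c)` or a `J`-vertex `(−c, b)`: NEGATIVE (it is `−Δ(|mass|, c)`). [this file] -/
theorem vertexTerm_neg_of_opposite {p q : ℝ} (hpq : 0 < p + q) (hsign : p * q < 0) :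
    (p + q) * log (p + q) - p * log p - q * log q < 0 := by
  rcases lt_or_gt_of_ne (show p ≠ 0 by rintro rfl; simp at hsign) with hp | hp
  · -- p = -c < 0 < q
    have hq : 0 < q := by nlinarith
    have h := delta_pos (p := p + q) (q := -p) hpq (by linarith)
    rw [show p + q + -p = q by ring, log_neg_eq_log] at h
    linarith
  · have hq : q < 0 := by nlinarith
    have h := delta_pos (p := p + q) (q := -q) hpq (by linarith)
    rw [show p + q + -q = p by ring, log_neg_eq_log] at h
    linarith

/-- **the balance as a vertex sum** (bookkeeping shared by both classes): at a nondegenerate zero of `D_{n+2}`,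
`Σ_{k≤n} (d_k+d_{k+1}−2f_k)·log x·e_k = Σ_{j<n} φ(e_j, e_{j+1})` with `e_k = D_kD_{k+1}x^{−2F_k}`. [this file] -/
theorem balance_eq_vertex_sum (n : ℕ) (x : ℝ) (hx : 0 < x)
    (hroot : (pathDet (fun _ => (1 : ℝ)) d (fun _ => (1 : ℝ)) f (n + 2)).eval x = 0)
    (hnd : ∀ k, 0 < k → k < n + 2 → (pathDet (fun _ => (1 : ℝ)) d (fun _ => (1 : ℝ)) f k).eval x ≠ 0) :
    ∑ k ∈ range (n + 1), (((d k + d (k + 1) : ℕ) : ℝ) - 2 * (f k : ℝ)) * log x *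
      ((pathDet (fun _ => (1 : ℝ)) d (fun _ => (1 : ℝ)) f k).eval x * (pathDet (fun _ => (1 : ℝ)) d (fun _ => (1 : ℝ)) f (k + 1)).eval x /
        x ^ (2 * ∑ j ∈ range k, f j)) =
      ∑ j ∈ range n,
        (((pathDet (fun _ => (1 : ℝ)) d (fun _ => (1 : ℝ)) f j).eval x * (pathDet (fun _ => (1 : ℝ)) d (fun _ => (1 : ℝ)) f (j + 1)).eval x /
            x ^ (2 * ∑ i ∈ range j, f i) +
          (pathDet (fun _ => (1 : ℝ)) d (fun _ => (1 : ℝ)) f (j + 1)).eval x * (pathDet (fun _ => (1 : ℝ)) d (fun _ => (1 : ℝ)) f (j + 2)).eval x /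
            x ^ (2 * ∑ i ∈ range (j + 1), f i)) *
          log ((pathDet (fun _ => (1 : ℝ)) d (fun _ => (1 : ℝ)) f j).eval x * (pathDet (fun _ => (1 : ℝ)) d (fun _ => (1 : ℝ)) f (j + 1)).eval x /
            x ^ (2 * ∑ i ∈ range j, f i) +
          (pathDet (fun _ => (1 : ℝ)) d (fun _ => (1 : ℝ)) f (j + 1)).eval x * (pathDet (fun _ => (1 : ℝ)) d (fun _ => (1 : ℝ)) f (j + 2)).eval x /
            x ^ (2 * ∑ i ∈ range (j + 1), f i)) -
        (pathDet (fun _ => (1 : ℝ)) d (fun _ => (1 : ℝ)) f j).eval x * (pathDet (fun _ => (1 : ℝ)) d (fun _ => (1 : ℝ)) f (j + 1)).eval x /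
            x ^ (2 * ∑ i ∈ range j, f i) *
          log ((pathDet (fun _ => (1 : ℝ)) d (fun _ => (1 : ℝ)) f j).eval x * (pathDet (fun _ => (1 : ℝ)) d (fun _ => (1 : ℝ)) f (j + 1)).eval x /
            x ^ (2 * ∑ i ∈ range j, f i)) -
        (pathDet (fun _ => (1 : ℝ)) d (fun _ => (1 : ℝ)) f (j + 1)).eval x * (pathDet (fun _ => (1 : ℝ)) d (fun _ => (1 : ℝ)) f (j + 2)).eval x /
            x ^ (2 * ∑ i ∈ range (j + 1), f i) *
          log ((pathDet (fun _ => (1 : ℝ)) d (fun _ => (1 : ℝ)) f (j + 1)).eval x * (pathDet (fun _ => (1 : ℝ)) d (fun _ => (1 : ℝ)) f (j + 2)).eval x /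
            x ^ (2 * ∑ i ∈ range (j + 1), f i))) := by
  obtain ⟨e, he⟩ : ∃ e : ℕ → ℝ, ∀ k, e k = (pathDet (fun _ => (1 : ℝ)) d (fun _ => (1 : ℝ)) f k).eval x *
      (pathDet (fun _ => (1 : ℝ)) d (fun _ => (1 : ℝ)) f (k + 1)).eval x / x ^ (2 * ∑ j ∈ range k, f j) := ⟨_, fun _ => rfl⟩
  obtain ⟨μ, hμ⟩ : ∃ μ : ℕ → ℝ, ∀ i, μ i = x ^ d i * (pathDet (fun _ => (1 : ℝ)) d (fun _ => (1 : ℝ)) f i).eval x ^ 2 /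
      x ^ (2 * ∑ j ∈ range i, f j) := ⟨_, fun _ => rfl⟩
  have hD0 : (pathDet (fun _ => (1 : ℝ)) d (fun _ => (1 : ℝ)) f 0).eval x = 1 := (eval_unit_zero_one d f x).1
  have hDne : ∀ k, k ≤ n + 1 → (pathDet (fun _ => (1 : ℝ)) d (fun _ => (1 : ℝ)) f k).eval x ≠ 0 := by
    intro k hk
    rcases Nat.eq_zero_or_pos k with rfl | hk0
    · rw [hD0]; exact one_ne_zero
    · exact hnd k hk0 (by omega)
  have hμe : ∀ i, μ (i + 1) = e i + e (i + 1) := by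
    intro i; rw [hμ, he, he]; exact (energy_succ_add d f x hx i).symm
  have hμ0 : μ 0 = e 0 := by rw [hμ, he]; exact energy_zero d f x
  have heN : e (n + 1) = 0 := by rw [he, show n + 1 + 1 = n + 2 by omega, hroot, mul_zero, zero_div]
  have hμn : μ (n + 1) = e n := by rw [hμe, heN, add_zero]
  have hterm : ∀ k ∈ range (n + 1), (((d k + d (k + 1) : ℕ) : ℝ) - 2 * (f k : ℝ)) * log x *
      ((pathDet (fun _ => (1 : ℝ)) d (fun _ => (1 : ℝ)) f k).eval x * (pathDet (fun _ => (1 : ℝ)) d (fun _ => (1 : ℝ)) f (k + 1)).eval x /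
        x ^ (2 * ∑ j ∈ range k, f j)) =
      e k * (log (μ k) + log (μ (k + 1)) - 2 * log (e k)) := by
    intro k hk
    rw [mem_range] at hk
    rw [hμ, hμ, he, log_ratio d f x hx k (hDne k (by omega)) (hDne (k + 1) (by omega))]
    ring
  rw [sum_congr rfl hterm, edge_sum_eq_vertex_sum n e μ hμ0 (fun i hi _ => by
    obtain ⟨i', rfl⟩ : ∃ i', i = i' + 1 := ⟨i - 1, by omega⟩
    rw [Nat.add_sub_cancel]; exact hμe i') hμn]
  refine sum_congr rfl fun j _ => ?_
  rw [he, he, show j + 1 + 1 = j + 2 by omega]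

/-! ### Top class: alternating pivots -/

/-- **TOP-CLASS DIRECTION LAW (all sizes, all exponents).**  At a nondegenerate zero of `D_{n+2}` (`n ≥ 1`) with ALTERNATING pivot products
`(−1)^k D_kD_{k+1} > 0` (`k ≤ n`), the balance `Σ_k (d_k+d_{k+1}−2f_k)·log x·e_k` is NEGATIVE: every interior vertex is an `N`- or `J`-vertex. [this file] -/
theorem balance_neg_of_alternating (n : ℕ) (hn : 1 ≤ n) (x : ℝ) (hx : 0 < x)
    (hroot : (pathDet (fun _ => (1 : ℝ)) d (fun _ => (1 : ℝ)) f (n + 2)).eval x = 0)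
    (hnd : ∀ k, 0 < k → k < n + 2 → (pathDet (fun _ => (1 : ℝ)) d (fun _ => (1 : ℝ)) f k).eval x ≠ 0)
    (halt : ∀ k, k ≤ n → 0 < (-1) ^ k *
      ((pathDet (fun _ => (1 : ℝ)) d (fun _ => (1 : ℝ)) f k).eval x * (pathDet (fun _ => (1 : ℝ)) d (fun _ => (1 : ℝ)) f (k + 1)).eval x)) :
    ∑ k ∈ range (n + 1), (((d k + d (k + 1) : ℕ) : ℝ) - 2 * (f k : ℝ)) * log x *
      ((pathDet (fun _ => (1 : ℝ)) d (fun _ => (1 : ℝ)) f k).eval x * (pathDet (fun _ => (1 : ℝ)) d (fun _ => (1 : ℝ)) f (k + 1)).eval x /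
        x ^ (2 * ∑ j ∈ range k, f j)) < 0 := by
  rw [balance_eq_vertex_sum d f n x hx hroot hnd]
  refine sum_neg (fun j hj => ?_) (nonempty_range_iff.2 (by omega))
  rw [mem_range] at hj
  -- masses are positive, consecutive energies have opposite signs
  have hmass := energy_succ_add d f x hx j
  have hDj1 : (pathDet (fun _ => (1 : ℝ)) d (fun _ => (1 : ℝ)) f (j + 1)).eval x ≠ 0 := hnd (j + 1) (by omega) (by omega)
  have hpos : 0 < x ^ d (j + 1) * (pathDet (fun _ => (1 : ℝ)) d (fun _ => (1 : ℝ)) f (j + 1)).eval x ^ 2 /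
      x ^ (2 * ∑ i ∈ range (j + 1), f i) := by positivity
  rw [← hmass] at hpos
  refine vertexTerm_neg_of_opposite hpos ?_
  have h1 := halt j (by omega)
  have h2 := halt (j + 1) (by omega)
  rw [show j + 1 + 1 = j + 2 by omega, pow_succ] at h2
  have hx1 : 0 < x ^ (2 * ∑ i ∈ range j, f i) := pow_pos hx _
  have hx2 : 0 < x ^ (2 * ∑ i ∈ range (j + 1), f i) := pow_pos hx _
  rw [div_mul_div_comm]
  apply div_neg_of_neg_of_pos _ (mul_pos hx1 hx2)
  have hsq : ((-1 : ℝ) ^ j) ^ 2 = 1 := by rw [← pow_mul]; exact Even.neg_one_pow ⟨j, by ring⟩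
  nlinarith [mul_pos h1 h2, hsq]

/-- top class, `x > 1`: `Σ_k (2f_k − d_k − d_{k+1})·e_k > 0` — one more negative eigenvalue beyond the zero. [this file] -/
theorem slopeEnergy_pos_above_one_of_alternating (n : ℕ) (hn : 1 ≤ n) (x : ℝ) (hx1 : 1 < x)
    (hroot : (pathDet (fun _ => (1 : ℝ)) d (fun _ => (1 : ℝ)) f (n + 2)).eval x = 0)
    (hnd : ∀ k, 0 < k → k < n + 2 → (pathDet (fun _ => (1 : ℝ)) d (fun _ => (1 : ℝ)) f k).eval x ≠ 0)
    (halt : ∀ k, k ≤ n → 0 < (-1) ^ k *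
      ((pathDet (fun _ => (1 : ℝ)) d (fun _ => (1 : ℝ)) f k).eval x * (pathDet (fun _ => (1 : ℝ)) d (fun _ => (1 : ℝ)) f (k + 1)).eval x)) :
    0 < ∑ k ∈ range (n + 1), ((2 * (f k : ℝ)) - ((d k + d (k + 1) : ℕ) : ℝ)) *
      ((pathDet (fun _ => (1 : ℝ)) d (fun _ => (1 : ℝ)) f k).eval x * (pathDet (fun _ => (1 : ℝ)) d (fun _ => (1 : ℝ)) f (k + 1)).eval x /
        x ^ (2 * ∑ j ∈ range k, f j)) := by
  have hx : 0 < x := one_pos.trans hx1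
  have hlog : 0 < log x := log_pos hx1
  have h := balance_neg_of_alternating d f n hn x hx hroot hnd halt
  rw [show ∑ k ∈ range (n + 1), (((d k + d (k + 1) : ℕ) : ℝ) - 2 * (f k : ℝ)) * log x *
      ((pathDet (fun _ => (1 : ℝ)) d (fun _ => (1 : ℝ)) f k).eval x * (pathDet (fun _ => (1 : ℝ)) d (fun _ => (1 : ℝ)) f (k + 1)).eval x /
        x ^ (2 * ∑ j ∈ range k, f j)) = -(log x * ∑ k ∈ range (n + 1), ((2 * (f k : ℝ)) - ((d k + d (k + 1) : ℕ) : ℝ)) *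
      ((pathDet (fun _ => (1 : ℝ)) d (fun _ => (1 : ℝ)) f k).eval x * (pathDet (fun _ => (1 : ℝ)) d (fun _ => (1 : ℝ)) f (k + 1)).eval x /
        x ^ (2 * ∑ j ∈ range k, f j))) by rw [mul_sum, ← sum_neg_distrib]; exact sum_congr rfl fun k _ => by ring] at h
  exact (pos_iff_pos_of_mul_pos (by linarith)).1 hlog

/-- top class, `x < 1`: `Σ_k (2f_k − d_k − d_{k+1})·e_k < 0` — the negative eigenvalue is added as `x` DECREASES away from `1`. [this file] -/
theorem slopeEnergy_neg_below_one_of_alternating (n : ℕ) (hn : 1 ≤ n) (x : ℝ) (hx : 0 < x) (hx1 : x < 1)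
    (hroot : (pathDet (fun _ => (1 : ℝ)) d (fun _ => (1 : ℝ)) f (n + 2)).eval x = 0)
    (hnd : ∀ k, 0 < k → k < n + 2 → (pathDet (fun _ => (1 : ℝ)) d (fun _ => (1 : ℝ)) f k).eval x ≠ 0)
    (halt : ∀ k, k ≤ n → 0 < (-1) ^ k *
      ((pathDet (fun _ => (1 : ℝ)) d (fun _ => (1 : ℝ)) f k).eval x * (pathDet (fun _ => (1 : ℝ)) d (fun _ => (1 : ℝ)) f (k + 1)).eval x)) :
    ∑ k ∈ range (n + 1), ((2 * (f k : ℝ)) - ((d k + d (k + 1) : ℕ) : ℝ)) *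
      ((pathDet (fun _ => (1 : ℝ)) d (fun _ => (1 : ℝ)) f k).eval x * (pathDet (fun _ => (1 : ℝ)) d (fun _ => (1 : ℝ)) f (k + 1)).eval x /
        x ^ (2 * ∑ j ∈ range k, f j)) < 0 := by
  have hlog : log x < 0 := log_neg hx hx1
  have h := balance_neg_of_alternating d f n hn x hx hroot hnd halt
  rw [show ∑ k ∈ range (n + 1), (((d k + d (k + 1) : ℕ) : ℝ) - 2 * (f k : ℝ)) * log x *
      ((pathDet (fun _ => (1 : ℝ)) d (fun _ => (1 : ℝ)) f k).eval x * (pathDet (fun _ => (1 : ℝ)) d (fun _ => (1 : ℝ)) f (k + 1)).eval x /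
        x ^ (2 * ∑ j ∈ range k, f j)) = (-log x) * ∑ k ∈ range (n + 1), ((2 * (f k : ℝ)) - ((d k + d (k + 1) : ℕ) : ℝ)) *
      ((pathDet (fun _ => (1 : ℝ)) d (fun _ => (1 : ℝ)) f k).eval x * (pathDet (fun _ => (1 : ℝ)) d (fun _ => (1 : ℝ)) f (k + 1)).eval x /
        x ^ (2 * ∑ j ∈ range k, f j)) by rw [mul_sum]; exact sum_congr rfl fun k _ => by ring] at h
  have hnl : 0 < -log x := by linarith
  rcases lt_or_ge (∑ k ∈ range (n + 1), ((2 * (f k : ℝ)) - ((d k + d (k + 1) : ℕ) : ℝ)) *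
      ((pathDet (fun _ => (1 : ℝ)) d (fun _ => (1 : ℝ)) f k).eval x * (pathDet (fun _ => (1 : ℝ)) d (fun _ => (1 : ℝ)) f (k + 1)).eval x /
        x ^ (2 * ∑ j ∈ range k, f j))) 0 with hlt | hcon
  · exact hlt
  · have := mul_nonneg hnl.le hcon
    linarith

/-! ### Bottom class: positive pivots -/

/-- **BOTTOM-CLASS DIRECTION LAW (all sizes, all exponents).**  At a nondegenerate zero of `D_{n+2}` (`n ≥ 1`) with ALL pivot products
positive (`D_kD_{k+1} > 0`, `k ≤ n`; the matrix is positive semidefinite there) the balance is POSITIVE: every interior vertex is an `A`-vertex.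
Hence `Σ_k L_k e_k > 0` below `1` (exit from positive definiteness) and `< 0` above `1` (entry). [this file] -/
theorem balance_pos_of_positive (n : ℕ) (hn : 1 ≤ n) (x : ℝ) (hx : 0 < x)
    (hroot : (pathDet (fun _ => (1 : ℝ)) d (fun _ => (1 : ℝ)) f (n + 2)).eval x = 0)
    (hnd : ∀ k, 0 < k → k < n + 2 → (pathDet (fun _ => (1 : ℝ)) d (fun _ => (1 : ℝ)) f k).eval x ≠ 0)
    (hposP : ∀ k, k ≤ n → 0 <
      (pathDet (fun _ => (1 : ℝ)) d (fun _ => (1 : ℝ)) f k).eval x * (pathDet (fun _ => (1 : ℝ)) d (fun _ => (1 : ℝ)) f (k + 1)).eval x) :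
    0 < ∑ k ∈ range (n + 1), (((d k + d (k + 1) : ℕ) : ℝ) - 2 * (f k : ℝ)) * log x *
      ((pathDet (fun _ => (1 : ℝ)) d (fun _ => (1 : ℝ)) f k).eval x * (pathDet (fun _ => (1 : ℝ)) d (fun _ => (1 : ℝ)) f (k + 1)).eval x /
        x ^ (2 * ∑ j ∈ range k, f j)) := by
  rw [balance_eq_vertex_sum d f n x hx hroot hnd]
  refine sum_pos (fun j hj => ?_) (nonempty_range_iff.2 (by omega))
  rw [mem_range] at hj
  have h1 := hposP j (by omega)
  have h2 := hposP (j + 1) (by omega)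
  rw [show j + 1 + 1 = j + 2 by omega] at h2
  exact delta_pos (div_pos h1 (pow_pos hx _)) (div_pos h2 (pow_pos hx _))

end StaticTridiagonalRealUnit
end Summit.ValiantsHypothesis.ValiantsHypothesis.Theorems.KPlusLogSqLaw
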